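import Summits.ValiantsHypothesis.ValiantsHypothesis.Theorems.KPlusLogSqLawTropicalBMarkedEdgeCoreFour
import Summits.ValiantsHypothesis.ValiantsHypothesis.Theorems.KPlusLogSqLawTropicalBMarkedEdgeFactorThree
import Summits.ValiantsHypothesis.ValiantsHypothesis.Theorems.KPlusLogSqLawTropicalBMarkedEdgeExchangeFour

/-!
# Route «KPlusLogSqLaw», crux `TropicalB` (stmt-ValiantsHypothesis-19771) — MARKED-EDGE sector, NESTED-TRIANGLE CORE, ALL sizes, part 6:
# FOUR-BODY Z-RIGIDITY (the height order) — inside all four covers, only `σZ` uses both gate loops `b0`, `b4`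

HONEST FRAMING.  Helper file (cell `pub-symmetroid`, seat val-sym-trop-p4 (g18), 2026-08-28; `--supports stmt-ValiantsHypothesis-19771 --as
helper`).  Continues parts 1–5 (`…MarkedEdgeCorePairs`, `…CoreZPairs`, `…CoreZUnique`, `…CoreTriangle`, `…CoreFour`) and uses the Hall
completion `three_factor` (`…MarkedEdgeFactorThree`) with g17's four-factor rigidity `FourBit.four_factors_eq` (p655398).  All-`m` structure of a
would-be realisation of the nested-triangle core {1,2},{1,3},{2,3},{0,4} (kernel-impossible at m = 6, p664896; located-exact impossible m ≤ 8;
OPEN for m ≥ 9).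

**THEOREM `core_BCEZ_unique`.**  In any realisation (any finite `V`), a cover `T` with `T i ∈ {σB i, σC i, σE i, σZ i}` for all `i` and
`T b0 = b0`, `T b4 = b4` IS `σZ`.  READING (the HEIGHT ORDER, for the successor who runs the common-path machinery): with
`α = σZ⁻¹σB`, `γ = σZ⁻¹σC`, `ε = σZ⁻¹σE`, the digraph on `V ∖ {b0, b4}` with arcs `i → α i, γ i, ε i` has NO directed cycle — equivalently
`V ∖ {b0, b4}` carries a linear order along which all three triangle covers move forward relative to `σZ`; every relative cycle passes a gate.
(Part 3 = the two-step-type case of this statement.)  Proof: `three_factor` completes `T` to `(T, M₂, M₃, M₄)`; `T` has odd slope ≥ 17, the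
`M`'s have even slopes without the gate loops; the loop at `b3` occurs twice outside `T`, so some `M` misses it (slope ≤ 6); the slope total 45
then forces the largest `M` above `29 − slope T`; `four_factors_eq` gives `T = σZ`.  Nothing here proves the law; nothing concerns `TropicalB`
in its window, `WeakLifting`, the doors, `MatrixDescartes` (stmt-ValiantsHypothesis-18050) or VP ≠ VNP.
-/

set_option linter.dupNamespace false
set_option autoImplicit false

namespace Summit.ValiantsHypothesis.ValiantsHypothesis.Theorems.KPlusLogSqLaw
namespace MarkedEdge
namespace Core

open Finset

variable {V : Type*} [Fintype V] [DecidableEq V]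

omit [Fintype V] in
/-- multiplicity ≤ 1 among four: if `t = v` then none of `x, y, z` is `v`. [folklore] -/
theorem excl4_of_count_le_one {t x y z v : V} {l : List V} (h : List.Perm [t, x, y, z] l) (hc : l.count v ≤ 1) (ht : t = v) :
    x ≠ v ∧ y ≠ v ∧ z ≠ v := by
  have hc' := h.count_eq v
  subst ht
  by_cases hx : x = t <;> by_cases hy : y = t <;> by_cases hz : z = t <;> simp [hx, hy, hz] at hc' ⊢ <;> omega

omit [Fintype V] in
/-- multiplicity ≤ 2 among four: `x, y, z` are not all `v`. [folklore] -/
theorem not_three_of_count_le_two {t x y z v : V} {l : List V} (h : List.Perm [t, x, y, z] l) (hc : l.count v ≤ 2) :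
    ¬ (x = v ∧ y = v ∧ z = v) := by
  have hc' := h.count_eq v
  rintro ⟨hx, hy, hz⟩
  by_cases ht : t = v <;> simp [ht, hx, hy, hz] at hc' <;> omega

omit [Fintype V] [DecidableEq V] in
/-- reorderings of a pointwise four-factorisation putting the first factor last. [folklore] -/
theorem perm4_rot {t x y z : V} {l : List V} (h : List.Perm [t, x, y, z] l) : List.Perm [x, y, z, t] l :=
  (((List.Perm.swap x t [y, z]).trans ((List.Perm.cons x (List.Perm.swap y t [z])).trans
    (List.Perm.cons x (List.Perm.cons y (List.Perm.swap z t []))))).symm).trans h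

omit [Fintype V] [DecidableEq V] in
/-- `[t, x, y, z] ~ l → [t, y, x, z] ~ l`. [folklore] -/
theorem perm4_swap12 {t x y z : V} {l : List V} (h : List.Perm [t, x, y, z] l) : List.Perm [t, y, x, z] l :=
  (List.Perm.cons t (List.Perm.swap x y [z])).trans h

omit [Fintype V] [DecidableEq V] in
/-- `[t, x, y, z] ~ l → [t, x, z, y] ~ l`. [folklore] -/
theorem perm4_swap23 {t x y z : V} {l : List V} (h : List.Perm [t, x, y, z] l) : List.Perm [t, x, z, y] l :=
  (List.Perm.cons t (List.Perm.cons x (List.Perm.swap y z []))).trans h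

section Core

variable (ok : V → V → Prop) (w g : V → V → ℤ) (b : Fin 5 → V)

/-- a cover not using the loop at `b0` has even slope. [folklore] -/
theorem slope_even_of_not_zero (hb : Function.Injective b)
    (hoff : ∀ i j, j ≠ i → g i j = 0) (hmark : ∀ l, g (b l) (b l) = (2 : ℤ) ^ (l : ℕ)) (haux : ∀ i, (∀ l, b l ≠ i) → g i i = 0)
    (M : Equiv.Perm V) (hM0 : M (b 0) ≠ b 0) : (∑ i, g i (M i)) % 2 = 0 := by
  rw [slope_eq_sum_marked g b hb hoff hmark haux M, Fin.sum_univ_five]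
  by_cases c1 : M (b 1) = b 1 <;> by_cases c2 : M (b 2) = b 2 <;> by_cases c3 : M (b 3) = b 3 <;> by_cases c4 : M (b 4) = b 4 <;>
    simp [hM0, c1, c2, c3, c4]

/-- a cover using the loop at `b0` has odd slope. [folklore] -/
theorem slope_odd_of_zero (hb : Function.Injective b)
    (hoff : ∀ i j, j ≠ i → g i j = 0) (hmark : ∀ l, g (b l) (b l) = (2 : ℤ) ^ (l : ℕ)) (haux : ∀ i, (∀ l, b l ≠ i) → g i i = 0)
    (T : Equiv.Perm V) (hT0 : T (b 0) = b 0) : (∑ i, g i (T i)) % 2 = 1 := by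
  rw [slope_eq_sum_marked g b hb hoff hmark haux T, Fin.sum_univ_five]
  by_cases c1 : T (b 1) = b 1 <;> by_cases c2 : T (b 2) = b 2 <;> by_cases c3 : T (b 3) = b 3 <;> by_cases c4 : T (b 4) = b 4 <;>
    simp [hT0, c1, c2, c3, c4]

/-- **FOUR-BODY Z-RIGIDITY (height order).**  In any realisation of the core (any finite `V`), the only cover inside the arcs of
`σB, σC, σE, σZ` that uses both loops `b0` and `b4` is `σZ`. [this seat's theorem] -/
theorem core_BCEZ_unique (hb : Function.Injective b)
    (hoff : ∀ i j, j ≠ i → g i j = 0) (hmark : ∀ l, g (b l) (b l) = (2 : ℤ) ^ (l : ℕ)) (haux : ∀ i, (∀ l, b l ≠ i) → g i i = 0)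
    {θB θC θE θZ : ℤ} {σB σC σE σZ : Equiv.Perm V} (hBC : θB < θC) (hCE : θC < θE) (hEZ : θE < θZ)
    (hB : (∀ i, ok i (σB i)) ∧ ∀ τ : Equiv.Perm V, τ ≠ σB → (∀ i, ok i (τ i)) →
      ∑ i, (w i (τ i) + θB * g i (τ i)) < ∑ i, (w i (σB i) + θB * g i (σB i)))
    (hC : (∀ i, ok i (σC i)) ∧ ∀ τ : Equiv.Perm V, τ ≠ σC → (∀ i, ok i (τ i)) →
      ∑ i, (w i (τ i) + θC * g i (τ i)) < ∑ i, (w i (σC i) + θC * g i (σC i)))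
    (hE : (∀ i, ok i (σE i)) ∧ ∀ τ : Equiv.Perm V, τ ≠ σE → (∀ i, ok i (τ i)) →
      ∑ i, (w i (τ i) + θE * g i (τ i)) < ∑ i, (w i (σE i) + θE * g i (σE i)))
    (hZ : (∀ i, ok i (σZ i)) ∧ ∀ τ : Equiv.Perm V, τ ≠ σZ → (∀ i, ok i (τ i)) →
      ∑ i, (w i (τ i) + θZ * g i (τ i)) < ∑ i, (w i (σZ i) + θZ * g i (σZ i)))
    (hB0 : σB (b 0) ≠ b 0) (hB1 : σB (b 1) = b 1) (hB2 : σB (b 2) = b 2) (hB3 : σB (b 3) ≠ b 3) (hB4 : σB (b 4) ≠ b 4)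
    (hC0 : σC (b 0) ≠ b 0) (hC1 : σC (b 1) = b 1) (hC2 : σC (b 2) ≠ b 2) (hC3 : σC (b 3) = b 3) (hC4 : σC (b 4) ≠ b 4)
    (hE0 : σE (b 0) ≠ b 0) (hE1 : σE (b 1) ≠ b 1) (hE2 : σE (b 2) = b 2) (hE3 : σE (b 3) = b 3) (hE4 : σE (b 4) ≠ b 4)
    (hZ0 : σZ (b 0) = b 0) (hZ1 : σZ (b 1) ≠ b 1) (hZ2 : σZ (b 2) ≠ b 2) (hZ3 : σZ (b 3) ≠ b 3) (hZ4 : σZ (b 4) = b 4)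
    (T : Equiv.Perm V) (hT : ∀ i, T i = σB i ∨ T i = σC i ∨ T i = σE i ∨ T i = σZ i) (hT0 : T (b 0) = b 0) (hT4 : T (b 4) = b 4) :
    T = σZ := by
  obtain ⟨M₂, M₃, M₄, hP⟩ := three_factor σB σC σE σZ T hT
  have sB := slope_B g b hb hoff hmark haux σB hB0 hB1 hB2 hB3 hB4
  have sC := slope_C g b hb hoff hmark haux σC hC0 hC1 hC2 hC3 hC4
  have sE := slope_E g b hb hoff hmark haux σE hE0 hE1 hE2 hE3 hE4
  have sZ := slope_Z g b hb hoff hmark haux σZ hZ0 hZ1 hZ2 hZ3 hZ4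
  have sT := slope_ge_seventeen g b hb hoff hmark haux T hT0 hT4
  have oT := slope_odd_of_zero g b hb hoff hmark haux T hT0
  have hsum := FourBit.sum_eq_of_factorisation₄ g hP
  rw [sB, sC, sE, sZ] at hsum
  -- the gate loops occur once; `T` uses them
  obtain ⟨n20, n30, n40⟩ := excl4_of_count_le_one (v := b 0) (hP (b 0)) (by simp [hB0, hC0, hE0, hZ0]) hT0
  obtain ⟨n24, n34, n44⟩ := excl4_of_count_le_one (v := b 4) (hP (b 4)) (by simp [hB4, hC4, hE4, hZ4]) hT4
  have e2 := slope_even_of_not_zero g b hb hoff hmark haux M₂ n20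
  have e3 := slope_even_of_not_zero g b hb hoff hmark haux M₃ n30
  have e4 := slope_even_of_not_zero g b hb hoff hmark haux M₄ n40
  -- the loop at `b3` occurs twice: some `M` misses it, hence has slope ≤ 6
  have x3 := not_three_of_count_le_two (v := b 3) (hP (b 3)) (by simp [hB3, hC3, hE3, hZ3])
  have hlow : (∑ i, g i (M₂ i)) ≤ 6 ∨ (∑ i, g i (M₃ i)) ≤ 6 ∨ (∑ i, g i (M₄ i)) ≤ 6 := by
    by_contra hcon
    push Not at hcon
    exact x3 ⟨fix_three_of_slope_gt_six g b hb hoff hmark haux M₂ n20 n24 hcon.1,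
      fix_three_of_slope_gt_six g b hb hoff hmark haux M₃ n30 n34 hcon.2.1,
      fix_three_of_slope_gt_six g b hb hoff hmark haux M₄ n40 n44 hcon.2.2⟩
  have hhi4 : (∑ i, g i (σZ i)) ≤ ∑ i, g i (T i) := by rw [sZ]; exact sT
  -- the six orderings (low factor first, high factor third, `T` last)
  have key : ∀ {F₁ F₂ F₃ : Equiv.Perm V}, (∀ i, List.Perm [F₁ i, F₂ i, F₃ i, T i] [σB i, σC i, σE i, σZ i]) →
      (∑ i, g i (F₁ i)) ≤ 6 → (∑ i, g i (F₂ i)) ≤ (∑ i, g i (F₃ i)) →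
      (∑ i, g i (F₁ i)) + (∑ i, g i (F₂ i)) + (∑ i, g i (F₃ i)) + (∑ i, g i (T i)) = 6 + 10 + 12 + 17 →
      (∑ i, g i (F₃ i)) % 2 = 0 → T = σZ := by
    intro F₁ F₂ F₃ hP' h1 h23 hs hev
    have hs34 : (∑ i, g i (σE i)) + (∑ i, g i (σZ i)) ≤ (∑ i, g i (F₃ i)) + ∑ i, g i (T i) := by rw [sE, sZ]; omega
    have hs234 : (∑ i, g i (σC i)) + (∑ i, g i (σE i)) + (∑ i, g i (σZ i))
        ≤ (∑ i, g i (F₂ i)) + (∑ i, g i (F₃ i)) + ∑ i, g i (T i) := by rw [sC, sE, sZ]; omega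
    exact (FourBit.four_factors_eq ok w g hBC hCE hEZ hB hC hE hZ hP' hhi4 hs34 hs234).2.2.2
  have hP1 : ∀ i, List.Perm [M₂ i, M₃ i, M₄ i, T i] [σB i, σC i, σE i, σZ i] := fun i => perm4_rot (hP i)
  rcases hlow with h2 | h3 | h4
  · rcases le_total (∑ i, g i (M₃ i)) (∑ i, g i (M₄ i)) with h34 | h43
    · exact key hP1 h2 h34 (by linarith) e4
    · exact key (fun i => perm4_rot (perm4_swap23 (hP i))) h2 h43 (by linarith) e3
  · rcases le_total (∑ i, g i (M₂ i)) (∑ i, g i (M₄ i)) with h24 | h42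
    · exact key (fun i => perm4_rot (perm4_swap12 (hP i))) h3 h24 (by linarith) e4
    · exact key (fun i => perm4_rot (perm4_swap23 (perm4_swap12 (hP i)))) h3 h42 (by linarith) e2
  · rcases le_total (∑ i, g i (M₂ i)) (∑ i, g i (M₃ i)) with h23 | h32
    · exact key (fun i => perm4_rot (perm4_swap12 (perm4_swap23 (hP i)))) h4 h23 (by linarith) e3
    · exact key (fun i => perm4_rot (perm4_swap12 (perm4_swap23 (perm4_swap12 (hP i))))) h4 h32 (by linarith) e2

end Core

end Core
end MarkedEdge
end Summit.ValiantsHypothesis.ValiantsHypothesis.Theorems.KPlusLogSqLaw
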